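import Literature.Barriers.AnomalousDissipation.CodimensionOneRigidityCovering
import Literature.Barriers.AnomalousDissipation.CodimensionOneRigidityFluxBound
import HarnessLib

/-!
# Proof of De Rosa–Inversi 2024, Thm. 1.2 on the torus (`DeRosaInversi2024_thm12_holds`)

This file discharges the named fact
`Literature.Barriers.AnomalousDissipation.DeRosaInversi2024_thm12` (`CodimensionOneRigidity.lean`):
a divergence-free field of class `L¹_t BV_x ∩ L^∞_{t,x}` on `(0,T) × T^d` carries no Duchon–Robert
dissipation; `section Pairing` collects the book-keeping, `section Assembly` the proof.

## Part 1 (`section Pairing`): additivity of the defect and approximation tools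

Book-keeping used in the final assembly:

* boundedness, measurability and integrability of the flux `D_ε(w)` of a bounded measurable field
  (`norm_duchonRobertApprox_le`, `stronglyMeasurable_duchonRobertApprox`), whence additivity of
  the `ε`-pairings `θ ↦ ∫₀ᵀ∫ D_ε θ` in the test function (`duchonRobert_pairing_add`) and, through the defining
  limit of `Torus.HasDuchonRobertDefect`, **additivity of the defect** on test functions supported
  in time where a bounded representative is available (`defect_add`, `defect_sum`);
* `exists_continuous_approx_indicator`: indicators of measurable sets are `L¹(μ)`-close to
  continuous `[0,1]`-valued functions (Mathlib's
  `Integrable.exists_boundedContinuous_integral_sub_le`, clamped);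
* `exists_smooth_cutoff_approx`: a continuous `[0,1]`-valued `g` is, after a compactly supported
  cut-off equal to `1` on a given compact set, uniformly approximated by smooth space–time
  functions (`exists_smooth_near`);
* `isSpaceTimeTestIoo_mul`: products `χ ψ` of a smooth `χ` with a test function `ψ` are test
  functions.

Everything is proved; theorems only.

## Part 2 (`section Assembly`): the proof of Thm. 1.2

The proof follows De Rosa–Inversi 2024, §4 (Ambrosio's anisotropic optimisation of
the kernel and Alberti's lemma), assembled from the support files:

1. `CodimensionOneRigidityVariation`/`Structure`: a bounded measurable representative `w` of `u`
   on a slab `[a, b] × T^d` around the time support of the test function `ψ`, a finite measure `μ`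
   and a trace-free matrix field `M` with `ζ ∂ⱼwᵢ = Mᵢⱼ μ` (`exists_density`; op. cit. (4.1)).
2. `CodimensionOneRigidityFluxBound`: `|D θ| ≤ Mbd² ∫ (∫ |Dρ(z)(Mz)| dz) Θ dμ` for every test
   function `θ` dominated by `Θ` and every kernel `ρ` (op. cit. (1.9) and Lemma 2.2).
3. `CodimensionOneRigidityAlberti`/`Covering`: finitely many kernels `ρᵢ` with
   `∫ |Dρᵢ(z)(M z)| ≤ η ‖M‖` on measurable pieces `Eᵢ` covering `{M ≠ 0, tr M = 0}` (op. cit.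
   Lemma 2.7 and the role of Prop. 2.8).
4. Here: a smooth near-partition `ψ = ∑ᵢ χᵢ ψ + (1 - ∑ᵢ χᵢ) ψ` with `χᵢ ≈ 1_{Eᵢ}` in `L¹(μ)`
   (`exists_continuous_approx_indicator`, `exists_smooth_cutoff_approx`), additivity of the defect
   (`defect_add`, `defect_sum`) and the flux bound with the kernel `ρᵢ` on the `i`-th piece give
   `|D ψ| ≤ C η` for every `η > 0`, hence `D ψ = 0`.

Everything is proved; theorems only.

## References

* L. De Rosa, M. Inversi, Comm. Math. Phys. 405 (2024), Thm. 1.2, §4 (arXiv:2307.09189).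
* J. Duchon, R. Robert, Nonlinearity 13 (2000), Prop. 2 (linearity of `D(u)` in the test function).
-/

noncomputable section

namespace Literature.Barriers.AnomalousDissipation

namespace CodimensionOneRigidity

section Pairing

open MeasureTheory TopologicalSpace Set Function Filter Topology
open scoped ENNReal NNReal RealInnerProductSpace ContDiff BoundedContinuousFunction

open Literature.Analysis Literature.Analysis.FunctionSpaces Literature.Analysis.FluidPDE

variable {d : Type} [Fintype d] [DecidableEq d]

/-! ### Test functions -/

section Test

variable {T : ℝ}

omit [DecidableEq d] in
/-- Sums of test functions supported in `(0, T)` are test functions supported in `(0, T)`. [folklore] -/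
theorem isSpaceTimeTestIoo_add {ψ χ : ℝ → UnitAddTorus d → ℝ} (hψ : Torus.IsSpaceTimeTestIoo T ψ)
    (hχ : Torus.IsSpaceTimeTestIoo T χ) : Torus.IsSpaceTimeTestIoo T (ψ + χ) := by
  refine ⟨hψ.1.add hχ.1, ?_⟩
  obtain ⟨ε₁, hε₁, h₁⟩ := hψ.2
  obtain ⟨ε₂, hε₂, h₂⟩ := hχ.2
  refine ⟨min ε₁ ε₂, lt_min hε₁ hε₂, fun t ht => ?_⟩
  rw [Pi.add_apply, h₁ t (ht.trans (min_le_left _ _)), h₂ t (ht.trans (min_le_right _ _)), add_zero]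

omit [DecidableEq d] in
/-- The zero function is a test function supported in `(0, T)`. [folklore] -/
theorem isSpaceTimeTestIoo_zero : Torus.IsSpaceTimeTestIoo T (0 : ℝ → UnitAddTorus d → ℝ) :=
  ⟨Torus.isSpaceTimeTest_zero T, 1, one_pos, fun _ _ => rfl⟩

omit [DecidableEq d] in
/-- Finite sums of test functions supported in `(0, T)` are test functions. [folklore] -/
theorem isSpaceTimeTestIoo_sum {ι : Type*} (s : Finset ι) {θ : ι → ℝ → UnitAddTorus d → ℝ}
    (hθ : ∀ i ∈ s, Torus.IsSpaceTimeTestIoo T (θ i)) :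
    Torus.IsSpaceTimeTestIoo T (∑ i ∈ s, θ i) := by
  classical
  induction s using Finset.induction_on with
  | empty => simpa using isSpaceTimeTestIoo_zero (d := d) (T := T)
  | insert a s ha ih =>
    rw [Finset.sum_insert ha]
    exact isSpaceTimeTestIoo_add (hθ a (Finset.mem_insert_self a s))
      (ih fun i hi => hθ i (Finset.mem_insert_of_mem hi))

omit [DecidableEq d] in
/-- **Products with smooth functions**: `χ ψ` is a test function supported in `(0, T)` for smooth `χ`
and a test function `ψ`. [folklore] -/
theorem isSpaceTimeTestIoo_mul {χ ψ : ℝ → UnitAddTorus d → ℝ} (hχ : ContDiff ℝ ∞ (Torus.stLift χ))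
    (hψ : Torus.IsSpaceTimeTestIoo T ψ) : Torus.IsSpaceTimeTestIoo T (fun t x => χ t x * ψ t x) := by
  obtain ⟨⟨hψs, T', hT', hψT'⟩, ε, hε, hψε⟩ := hψ
  have hs : Torus.stLift (fun t x => χ t x * ψ t x) = fun p => Torus.stLift χ p * Torus.stLift ψ p := rfl
  refine ⟨⟨by rw [hs]; exact hχ.mul hψs, T', hT', fun t ht => ?_⟩, ε, hε, fun t ht => ?_⟩
  · funext x
    simp [hψT' t ht]
  · funext x
    simp [hψε t ht]

end Test

/-! ### The flux of a bounded measurable field: bound, measurability, integrability -/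

section Flux

variable {w : ℝ → UnitAddTorus d → EuclideanSpace ℝ d} {Mbd : ℝ} {ρ : EuclideanSpace ℝ d → ℝ} {ε : ℝ}

omit [DecidableEq d] in
/-- The gradient of a rescaled mollifier is integrable (continuous with compact support). [folklore] -/
theorem integrable_norm_gradient_mollifierScale (hρ : FluidPDE.IsMollifier ρ) (hε : 0 < ε) :
    Integrable (fun ξ => ‖gradient (FluidPDE.mollifierScale ε ρ) ξ‖) volume := by
  refine (Continuous.integrable_of_hasCompactSupport (Torus.continuous_gradient_mollifierScale hρ hε)
    ?_).norm
  have h : gradient (FluidPDE.mollifierScale ε ρ) =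
      (InnerProductSpace.toDual ℝ (EuclideanSpace ℝ d)).symm ∘ fderiv ℝ (FluidPDE.mollifierScale ε ρ) := by
    funext ξ; rfl
  rw [h]
  exact ((hρ.mollifierScale hε).2.1.fderiv (𝕜 := ℝ)).comp_left (map_zero _)

omit [DecidableEq d] in
/-- **Uniform bound of the flux of a bounded field**:
`‖D_ε(v)(x)‖ ≤ ¼ (2 Mbd)³ ∫ |∇ρ^ε|` when `‖v‖ ≤ Mbd`. [folklore] -/
theorem norm_duchonRobertApprox_le (hρ : FluidPDE.IsMollifier ρ) (hε : 0 < ε)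
    {v : UnitAddTorus d → EuclideanSpace ℝ d} (hv : ∀ x, ‖v x‖ ≤ Mbd) (x : UnitAddTorus d) :
    ‖Torus.duchonRobertApprox ρ ε v x‖ ≤
      4⁻¹ * ((2 * Mbd) ^ 3 * ∫ ξ, ‖gradient (FluidPDE.mollifierScale ε ρ) ξ‖) := by
  have hMbd : 0 ≤ Mbd := (norm_nonneg _).trans (hv x)
  have hδ : ∀ ξ, ‖Torus.increment v ξ x‖ ≤ 2 * Mbd := fun ξ => by
    rw [Torus.increment, two_mul]
    exact (norm_sub_le _ _).trans (add_le_add (hv _) (hv _))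
  rw [Torus.duchonRobertApprox, norm_mul, Real.norm_of_nonneg (by norm_num : (0 : ℝ) ≤ 4⁻¹)]
  refine mul_le_mul_of_nonneg_left ?_ (by norm_num)
  rw [← integral_const_mul]
  refine norm_integral_le_of_norm_le ((integrable_norm_gradient_mollifierScale hρ hε).const_mul _)
    (ae_of_all _ fun ξ => ?_)
  rw [norm_mul, Real.norm_of_nonneg (sq_nonneg _)]
  calc ‖⟪gradient (FluidPDE.mollifierScale ε ρ) ξ, Torus.increment v ξ x⟫‖ * ‖Torus.increment v ξ x‖ ^ 2
      ≤ (‖gradient (FluidPDE.mollifierScale ε ρ) ξ‖ * ‖Torus.increment v ξ x‖) *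
          ‖Torus.increment v ξ x‖ ^ 2 := by
        gcongr
        exact norm_inner_le_norm _ _
    _ = ‖gradient (FluidPDE.mollifierScale ε ρ) ξ‖ * ‖Torus.increment v ξ x‖ ^ 3 := by ring
    _ ≤ ‖gradient (FluidPDE.mollifierScale ε ρ) ξ‖ * (2 * Mbd) ^ 3 := by
        gcongr
        · exact hδ ξ
    _ = (2 * Mbd) ^ 3 * ‖gradient (FluidPDE.mollifierScale ε ρ) ξ‖ := mul_comm _ _

omit [DecidableEq d] in
/-- **Joint measurability of the flux** `(t, x) ↦ D_ε(w(t))(x)` of a jointly strongly measurable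
field (a parametric integral, Fubini). [folklore] -/
theorem stronglyMeasurable_duchonRobertApprox (hw : StronglyMeasurable (uncurry w))
    (hρ : FluidPDE.IsMollifier ρ) (hε : 0 < ε) :
    StronglyMeasurable fun q : ℝ × UnitAddTorus d => Torus.duchonRobertApprox ρ ε (w q.1) q.2 := by
  have hgc := Torus.continuous_gradient_mollifierScale hρ hε
  have hinc : StronglyMeasurable fun r : (ℝ × UnitAddTorus d) × EuclideanSpace ℝ d =>
      Torus.increment (w r.1.1) r.2 r.1.2 := by
    simp only [Torus.increment]
    refine StronglyMeasurable.sub ?_ (hw.comp_measurable measurable_fst)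
    exact hw.comp_measurable ((measurable_fst.comp measurable_fst).prodMk
      ((measurable_snd.comp measurable_fst).add (Torus.measurable_proj.comp measurable_snd)))
  have hG : StronglyMeasurable fun r : (ℝ × UnitAddTorus d) × EuclideanSpace ℝ d =>
      ⟪gradient (FluidPDE.mollifierScale ε ρ) r.2, Torus.increment (w r.1.1) r.2 r.1.2⟫ *
        ‖Torus.increment (w r.1.1) r.2 r.1.2‖ ^ 2 :=
    ((hgc.stronglyMeasurable.comp_measurable measurable_snd).inner hinc).mul (hinc.norm.pow 2)
  have h := hG.integral_prod_right' (ν := (volume : Measure (EuclideanSpace ℝ d)))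
  exact h.const_mul _

omit [DecidableEq d] in
/-- Integrability in space of `D_ε(w(t)) θ(t)` for bounded continuous `θ`. [folklore] -/
theorem integrable_duchonRobertApprox_mul_slice (hw : StronglyMeasurable (uncurry w))
    (hwb : ∀ t x, ‖w t x‖ ≤ Mbd) (hρ : FluidPDE.IsMollifier ρ) (hε : 0 < ε)
    {θ : ℝ → UnitAddTorus d → ℝ} (hθc : Continuous (uncurry θ)) (t : ℝ) :
    Integrable (fun x => Torus.duchonRobertApprox ρ ε (w t) x * θ t x) volume := by
  have hm : StronglyMeasurable fun x => Torus.duchonRobertApprox ρ ε (w t) x := by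
    have hgc := Torus.continuous_gradient_mollifierScale hρ hε
    have hwt : StronglyMeasurable (w t) := stronglyMeasurable_slice hw t
    have hinc : StronglyMeasurable fun r : UnitAddTorus d × EuclideanSpace ℝ d =>
        Torus.increment (w t) r.2 r.1 := by
      simp only [Torus.increment]
      exact (hwt.comp_measurable (measurable_fst.add (Torus.measurable_proj.comp measurable_snd))).sub
        (hwt.comp_measurable measurable_fst)
    have hG : StronglyMeasurable fun r : UnitAddTorus d × EuclideanSpace ℝ d =>
        ⟪gradient (FluidPDE.mollifierScale ε ρ) r.2, Torus.increment (w t) r.2 r.1⟫ *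
          ‖Torus.increment (w t) r.2 r.1‖ ^ 2 :=
      ((hgc.stronglyMeasurable.comp_measurable measurable_snd).inner hinc).mul (hinc.norm.pow 2)
    exact (hG.integral_prod_right' (ν := (volume : Measure (EuclideanSpace ℝ d)))).const_mul _
  refine Integrable.bdd_mul (c := 4⁻¹ * ((2 * Mbd) ^ 3 *
    ∫ ξ, ‖gradient (FluidPDE.mollifierScale ε ρ) ξ‖)) ?_ hm.aestronglyMeasurable
    (ae_of_all _ fun x => norm_duchonRobertApprox_le hρ hε (hwb t) x)
  exact (hθc.comp (Continuous.prodMk_right t)).integrable_unitAddTorus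

omit [DecidableEq d] in
/-- Integrability in time (on `(0, T)`) of `t ↦ ∫ D_ε(w(t)) θ(t) dx` for bounded continuous `θ`
vanishing outside a compact time interval. [folklore] -/
theorem integrable_duchonRobertApprox_pairing (hw : StronglyMeasurable (uncurry w))
    (hwb : ∀ t x, ‖w t x‖ ≤ Mbd) (hρ : FluidPDE.IsMollifier ρ) (hε : 0 < ε)
    {θ : ℝ → UnitAddTorus d → ℝ} (hθc : Continuous (uncurry θ)) {a' b' : ℝ}
    (hθ0 : ∀ t ∉ Icc a' b', θ t = 0) (T : ℝ) :
    Integrable (fun t => ∫ x, Torus.duchonRobertApprox ρ ε (w t) x * θ t x)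
      (volume.restrict (Ioo 0 T)) := by
  obtain ⟨hθc', Cθ, hCθ⟩ : Continuous (uncurry θ) ∧ ∃ C, ∀ q, ‖uncurry θ q‖ ≤ C := by
    refine ⟨hθc, hθc.bounded_above_of_compact_support ?_⟩
    refine HasCompactSupport.intro' (K := Icc a' b' ×ˢ (univ : Set (UnitAddTorus d)))
      (isCompact_Icc.prod isCompact_univ) (isClosed_Icc.prod isClosed_univ) fun q hq => ?_
    have ht : q.1 ∉ Icc a' b' := fun h => hq ⟨h, mem_univ _⟩
    simp [uncurry, hθ0 q.1 ht]
  set C : ℝ := 4⁻¹ * ((2 * Mbd) ^ 3 * ∫ ξ, ‖gradient (FluidPDE.mollifierScale ε ρ) ξ‖) with hC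
  have hmeas : StronglyMeasurable fun t => ∫ x, Torus.duchonRobertApprox ρ ε (w t) x * θ t x :=
    ((stronglyMeasurable_duchonRobertApprox hw hρ hε).mul hθc.stronglyMeasurable).integral_prod_right'
      (ν := (volume : Measure (UnitAddTorus d)))
  refine Integrable.mono_measure ?_ Measure.restrict_le_self
  refine IntegrableOn.integrable_of_forall_notMem_eq_zero (s := Icc a' b') ?_ fun t ht => ?_
  · refine IntegrableOn.of_bound measure_Icc_lt_top hmeas.aestronglyMeasurable.restrict (C * Cθ) ?_
    refine ae_of_all _ fun t => (norm_integral_le_integral_norm _).trans ?_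
    calc ∫ x, ‖Torus.duchonRobertApprox ρ ε (w t) x * θ t x‖
        ≤ ∫ _x, C * Cθ ∂(volume : Measure (UnitAddTorus d)) := by
          refine integral_mono_of_nonneg (ae_of_all _ fun x => norm_nonneg _) (integrable_const _)
            (ae_of_all _ fun x => ?_)
          dsimp only
          rw [norm_mul]
          exact mul_le_mul (norm_duchonRobertApprox_le hρ hε (hwb t) x) (hCθ (t, x))
            (norm_nonneg _) ((norm_nonneg _).trans (norm_duchonRobertApprox_le hρ hε (hwb t) x))
      _ = C * Cθ := by simp
  · simp [hθ0 t ht]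

omit [DecidableEq d] in
/-- **Additivity of the `ε`-pairings** in the test function. [folklore] -/
theorem duchonRobert_pairing_add (hw : StronglyMeasurable (uncurry w))
    (hwb : ∀ t x, ‖w t x‖ ≤ Mbd)
    (hρ : FluidPDE.IsMollifier ρ) (hε : 0 < ε) {θ₁ θ₂ : ℝ → UnitAddTorus d → ℝ}
    (h₁ : Continuous (uncurry θ₁)) (h₂ : Continuous (uncurry θ₂)) {a' b' : ℝ}
    (h₁0 : ∀ t ∉ Icc a' b', θ₁ t = 0) (h₂0 : ∀ t ∉ Icc a' b', θ₂ t = 0) (T : ℝ) :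
    ∫ t in Ioo 0 T, ∫ x, Torus.duchonRobertApprox ρ ε (w t) x * (θ₁ + θ₂) t x =
      (∫ t in Ioo 0 T, ∫ x, Torus.duchonRobertApprox ρ ε (w t) x * θ₁ t x) +
        ∫ t in Ioo 0 T, ∫ x, Torus.duchonRobertApprox ρ ε (w t) x * θ₂ t x := by
  rw [← integral_add (integrable_duchonRobertApprox_pairing hw hwb hρ hε h₁ h₁0 T)
    (integrable_duchonRobertApprox_pairing hw hwb hρ hε h₂ h₂0 T)]
  refine integral_congr_ae (ae_of_all _ fun t => ?_)
  dsimp only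
  rw [← integral_add (integrable_duchonRobertApprox_mul_slice hw hwb hρ hε h₁ t)
    (integrable_duchonRobertApprox_mul_slice hw hwb hρ hε h₂ t)]
  refine integral_congr_ae (ae_of_all _ fun x => ?_)
  simp only [Pi.add_apply]
  ring

end Flux

/-! ### Additivity of the defect -/

section Defect

variable {T : ℝ} {u w : ℝ → UnitAddTorus d → EuclideanSpace ℝ d} {D : Torus.STFunctional d}
  {Mbd a b a' b' : ℝ}

omit [DecidableEq d] in
/-- A test function vanishing outside `[a', b']` has continuous uncurried version. [folklore] -/
theorem continuous_uncurry_of_test {θ : ℝ → UnitAddTorus d → ℝ} (hθ : Torus.IsSpaceTimeTestIoo T θ) :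
    Continuous (uncurry θ) :=
  Torus.continuous_uncurry_of_continuous_stLift hθ.1.1.continuous

omit [DecidableEq d] in
/-- **Additivity of the Duchon–Robert defect** on test functions supported in a time interval where a
bounded representative of the field is available (Duchon–Robert 2000, Prop. 2: `D(u)` is a
distribution; here from the additivity of the `ε`-pairings and the defining limit). [folklore] -/
theorem defect_add (hD : Torus.HasDuchonRobertDefect T u D) (hw : StronglyMeasurable (uncurry w))
    (hwb : ∀ t x, ‖w t x‖ ≤ Mbd) (hsub : Icc a' b' ⊆ Icc a b)
    (huw : ∀ᵐ t ∂(volume.restrict (Icc a b)), w t =ᵐ[volume] u t)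
    {θ₁ θ₂ : ℝ → UnitAddTorus d → ℝ} (h₁ : Torus.IsSpaceTimeTestIoo T θ₁)
    (h₂ : Torus.IsSpaceTimeTestIoo T θ₂) (h₁0 : ∀ t ∉ Icc a' b', θ₁ t = 0)
    (h₂0 : ∀ t ∉ Icc a' b', θ₂ t = 0) : D (θ₁ + θ₂) = D θ₁ + D θ₂ := by
  obtain ⟨ρ, hρ⟩ := FluidPDE.exists_isMollifier (d := d)
  have h120 : ∀ t ∉ Icc a' b', (θ₁ + θ₂) t = 0 := fun t ht => by
    rw [Pi.add_apply, h₁0 t ht, h₂0 t ht, add_zero]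
  have hlim := hD ρ hρ (θ₁ + θ₂) (isSpaceTimeTestIoo_add h₁ h₂)
  have hlim' : Tendsto (fun ε => ∫ t in Ioo 0 T, ∫ x, Torus.duchonRobertApprox ρ ε (u t) x * (θ₁ + θ₂) t x)
      (𝓝[>] 0) (𝓝 (D θ₁ + D θ₂)) := by
    have h := (hD ρ hρ θ₁ h₁).add (hD ρ hρ θ₂ h₂)
    refine h.congr' (eventually_nhdsWithin_of_forall fun ε hε => ?_)
    show _ = ∫ t in Ioo 0 T, ∫ x, Torus.duchonRobertApprox ρ ε (u t) x * (θ₁ + θ₂) t x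
    rw [integral_duchonRobert_congr hsub huw h₁0 ρ ε, integral_duchonRobert_congr hsub huw h₂0 ρ ε,
      integral_duchonRobert_congr hsub huw h120 ρ ε]
    exact (duchonRobert_pairing_add hw hwb hρ hε (continuous_uncurry_of_test h₁)
      (continuous_uncurry_of_test h₂) h₁0 h₂0 T).symm
  exact tendsto_nhds_unique hlim hlim'

omit [DecidableEq d] in
/-- The defect of the zero test function vanishes. [folklore] -/
theorem defect_zero (hD : Torus.HasDuchonRobertDefect T u D) : D 0 = 0 := by
  obtain ⟨ρ, hρ⟩ := FluidPDE.exists_isMollifier (d := d)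
  have h := hD ρ hρ 0 isSpaceTimeTestIoo_zero
  simp only [Pi.zero_apply, mul_zero, integral_zero] at h
  exact tendsto_nhds_unique h tendsto_const_nhds

omit [DecidableEq d] in
/-- **Finite additivity of the defect** (induction on `defect_add`). [folklore] -/
theorem defect_sum (hD : Torus.HasDuchonRobertDefect T u D) (hw : StronglyMeasurable (uncurry w))
    (hwb : ∀ t x, ‖w t x‖ ≤ Mbd) (hsub : Icc a' b' ⊆ Icc a b)
    (huw : ∀ᵐ t ∂(volume.restrict (Icc a b)), w t =ᵐ[volume] u t)
    {ι : Type*} (s : Finset ι) {θ : ι → ℝ → UnitAddTorus d → ℝ}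
    (hθ : ∀ i ∈ s, Torus.IsSpaceTimeTestIoo T (θ i)) (hθ0 : ∀ i ∈ s, ∀ t ∉ Icc a' b', θ i t = 0) :
    D (∑ i ∈ s, θ i) = ∑ i ∈ s, D (θ i) := by
  classical
  induction s using Finset.induction_on with
  | empty => simpa using defect_zero hD
  | insert k s hk ih =>
    rw [Finset.sum_insert hk, Finset.sum_insert hk]
    have hθk := hθ k (Finset.mem_insert_self k s)
    have hθs : ∀ i ∈ s, Torus.IsSpaceTimeTestIoo T (θ i) := fun i hi => hθ i (Finset.mem_insert_of_mem hi)
    have hθs0 : ∀ i ∈ s, ∀ t ∉ Icc a' b', θ i t = 0 := fun i hi =>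
      hθ0 i (Finset.mem_insert_of_mem hi)
    have hsum0 : ∀ t ∉ Icc a' b', (∑ i ∈ s, θ i) t = 0 := fun t ht => by
      rw [Finset.sum_apply]
      exact Finset.sum_eq_zero fun i hi => hθs0 i hi t ht
    rw [defect_add hD hw hwb hsub huw hθk (isSpaceTimeTestIoo_sum s hθs)
      (hθ0 k (Finset.mem_insert_self k s)) hsum0, ih hθs hθs0]

end Defect

/-! ### Approximation tools -/

section Approx

variable {μ : Measure (ℝ × UnitAddTorus d)}

omit [DecidableEq d] in
/-- **Indicators are `L¹(μ)`-close to continuous `[0,1]`-valued functions** (density of bounded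
continuous functions in `L¹` of a finite Borel measure on a metrisable space, then clamping to
`[0,1]`). [folklore] -/
theorem exists_continuous_approx_indicator [IsFiniteMeasure μ] {E : Set (ℝ × UnitAddTorus d)}
    (hE : MeasurableSet E) {τ : ℝ} (hτ : 0 < τ) :
    ∃ g : ℝ × UnitAddTorus d → ℝ, Continuous g ∧ (∀ q, 0 ≤ g q ∧ g q ≤ 1) ∧
      ∫ q, |g q - E.indicator 1 q| ∂μ ≤ τ := by
  have hind : Integrable (E.indicator (1 : ℝ × UnitAddTorus d → ℝ)) μ :=
    (integrable_const (1 : ℝ)).indicator hE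
  obtain ⟨g, hg, -⟩ := hind.exists_boundedContinuous_integral_sub_le hτ
  have hgi : Integrable (fun q => g q) μ := g.integrable μ
  refine ⟨fun q => max 0 (min 1 (g q)), continuous_const.max (continuous_const.min g.continuous),
    fun q => ⟨le_max_left _ _, max_le zero_le_one (min_le_left _ _)⟩, ?_⟩
  refine le_trans (integral_mono_of_nonneg (ae_of_all _ fun q => abs_nonneg _) (hind.sub hgi).norm
    (ae_of_all _ fun q => ?_)) (by simpa only [Pi.sub_apply] using hg)
  dsimp only
  have h01 : 0 ≤ E.indicator (1 : ℝ × UnitAddTorus d → ℝ) q ∧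
      E.indicator (1 : ℝ × UnitAddTorus d → ℝ) q ≤ 1 := by
    by_cases hq : q ∈ E <;> simp [hq]
  rw [Pi.sub_apply, Real.norm_eq_abs, abs_sub_comm (E.indicator 1 q)]
  have e1 : E.indicator (1 : ℝ × UnitAddTorus d → ℝ) q =
      max 0 (min 1 (E.indicator (1 : ℝ × UnitAddTorus d → ℝ) q)) := by
    rw [min_eq_right h01.2, max_eq_right h01.1]
  conv_lhs => rw [e1]
  refine (abs_max_sub_max_le_max _ _ _ _).trans ?_
  rw [sub_self, abs_zero]
  refine max_le (abs_nonneg _) ((abs_min_sub_min_le_max _ _ _ _).trans ?_)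
  rw [sub_self, abs_zero]
  exact max_le (abs_nonneg _) le_rfl

omit [DecidableEq d] in
/-- **Smooth approximation under a cut-off**: a continuous `[0,1]`-valued `g` admits, for every
compact `Kc` and `τ > 0`, a smooth space–time `χ` with `|χ| ≤ g + τ` everywhere and `|χ - g| ≤ τ`
on `Kc` (cut `g` off by a Urysohn function of `Kc`, then `exists_smooth_near`). [folklore] -/
theorem exists_smooth_cutoff_approx {g : ℝ × UnitAddTorus d → ℝ} (hg : Continuous g)
    (hg01 : ∀ q, 0 ≤ g q ∧ g q ≤ 1) {Kc : Set (ℝ × UnitAddTorus d)} (hKc : IsCompact Kc)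
    {τ : ℝ} (hτ : 0 < τ) :
    ∃ χ : ℝ → UnitAddTorus d → ℝ, ContDiff ℝ ∞ (Torus.stLift χ) ∧
      (∀ t x, |χ t x| ≤ g (t, x) + τ) ∧ ∀ q ∈ Kc, |χ q.1 q.2 - g q| ≤ τ := by
  obtain ⟨κ, hκ1, -, hκs, hκ01⟩ := exists_continuous_one_zero_of_isCompact hKc isClosed_empty
    (disjoint_empty Kc)
  have hf : Continuous fun q => κ q * g q := κ.continuous.mul hg
  have hfs : HasCompactSupport fun q => κ q * g q := hκs.mul_right
  obtain ⟨χ, hχs, -, hχf⟩ := exists_smooth_near hf hfs hτ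
  refine ⟨χ, hχs, fun t x => ?_, fun q hq => ?_⟩
  · have h := hχf t x
    have hκ := hκ01 (t, x)
    have hgq := hg01 (t, x)
    have hκg : κ (t, x) * g (t, x) ≤ g (t, x) := by nlinarith [hκ.1, hκ.2, hgq.1]
    have hκg0 : 0 ≤ κ (t, x) * g (t, x) := mul_nonneg hκ.1 hgq.1
    rw [abs_le] at h ⊢
    constructor <;> linarith
  · have h := hχf q.1 q.2
    have hκq : κ (q.1, q.2) = 1 := hκ1 hq
    rw [hκq, one_mul] at h
    exact h

end Approx

end Pairing

section Assembly

open MeasureTheory TopologicalSpace Set Function Filter Topology Metric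
open scoped ENNReal NNReal RealInnerProductSpace ContDiff

open Literature.Analysis Literature.Analysis.FunctionSpaces Literature.Analysis.FluidPDE

variable {d : Type} [Fintype d] [DecidableEq d]

/-! ### Invariance of the hypotheses under a.e. modification -/

/-- The total variation only depends on the a.e.-class of the field. [folklore] -/
theorem torusTotalVariation_congr_ae {v v' : UnitAddTorus d → EuclideanSpace ℝ d}
    (h : v =ᵐ[volume] v') : torusTotalVariation v = torusTotalVariation v' := by
  unfold torusTotalVariation
  refine iSup_congr fun Φ => iSup_congr fun _ => iSup_congr fun _ => ?_
  rw [integral_congr_ae (h.mono fun x hx => by simp only [hx] : (fun x => ∑ i, v x i *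
    Torus.divergence (Φ i) x) =ᵐ[volume] fun x => ∑ i, v' x i * Torus.divergence (Φ i) x)]

omit [DecidableEq d] in
/-- Weak divergence-freeness only depends on the a.e.-class of the field. [folklore] -/
theorem isWeaklyDivFree_congr_ae {v v' : UnitAddTorus d → EuclideanSpace ℝ d} (h : v =ᵐ[volume] v')
    (hv' : Torus.IsWeaklyDivFree v') : Torus.IsWeaklyDivFree v := by
  intro θ hθ
  rw [← hv' θ hθ]
  exact integral_congr_ae (h.mono fun x hx => by simp only [hx])

/-! ### A smooth time cut-off -/

omit [Fintype d] [DecidableEq d] in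
/-- A smooth cut-off in time: `ζ = 1` on `[a', b']`, `0 ≤ ζ ≤ 1`, `ζ = 0` outside `[a, b]`, for
`a < a' ≤ b' < b` (a bump function of the interval). [folklore] -/
theorem exists_time_cutoff {a a' b' b : ℝ} (ha : a < a') (hab : a' ≤ b') (hb : b' < b) :
    ∃ ζ : ℝ → ℝ, ContDiff ℝ ∞ ζ ∧ (∀ t, 0 ≤ ζ t ∧ ζ t ≤ 1) ∧ (∀ t ∈ Icc a' b', ζ t = 1) ∧
      ∀ t ∉ Icc a b, ζ t = 0 := by
  obtain ⟨δ, hδdef⟩ : ∃ δ : ℝ, δ = min (a' - a) (b - b') / 3 := ⟨_, rfl⟩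
  have hδ0 : 0 < δ := by
    have : 0 < min (a' - a) (b - b') := lt_min (by linarith) (by linarith)
    rw [hδdef]; positivity
  have hδa : 3 * δ ≤ a' - a := by
    have := min_le_left (a' - a) (b - b'); rw [hδdef]; linarith
  have hδb : 3 * δ ≤ b - b' := by
    have := min_le_right (a' - a) (b - b'); rw [hδdef]; linarith
  let f : ContDiffBump ((a' + b') / 2) :=
    ⟨(b' - a') / 2 + δ, (b' - a') / 2 + 2 * δ, by linarith, by linarith⟩
  refine ⟨f, f.contDiff, fun t => ⟨f.nonneg, f.le_one⟩, fun t ht => ?_, fun t ht => ?_⟩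
  · refine f.one_of_mem_closedBall ?_
    rw [mem_closedBall, Real.dist_eq, abs_le]
    constructor
    · show -((b' - a') / 2 + δ) ≤ t - (a' + b') / 2
      linarith [ht.1]
    · show t - (a' + b') / 2 ≤ (b' - a') / 2 + δ
      linarith [ht.2]
  · refine f.zero_of_le_dist ?_
    show (b' - a') / 2 + 2 * δ ≤ dist t ((a' + b') / 2)
    rw [Real.dist_eq]
    simp only [mem_Icc, not_and_or, not_le] at ht
    rcases ht with ht | ht
    · rw [abs_of_neg (by linarith)]
      linarith
    · rw [abs_of_pos (by linarith)]
      linarith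

/-! ### Elementary integral estimates for the pieces of the partition -/

omit [Fintype d] [DecidableEq d] in
/-- The estimate for the `i`-th piece: if `0 ≤ f ≤ L K`, `f ≤ η K` on `E`, `0 ≤ g ≤ 1` with
`‖g - 1_E‖_{L¹(μ)} ≤ τ` and `‖p‖ ≤ C`, then
`∫ f (g + τ) ‖p‖ dμ ≤ C K (η μ(E) + L τ (μ(univ) + 1))`. [folklore] -/
theorem integral_piece_le {X : Type*} [MeasurableSpace X] {μ : Measure X} [IsFiniteMeasure μ]
    {Y : Type*} [NormedAddCommGroup Y] {f g : X → ℝ} {p : X → Y} {E : Set X}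
    (hE : MeasurableSet E) {η K L τ C : ℝ} (hK : 0 ≤ K) (hL : 0 ≤ L) (hτ : 0 ≤ τ)
    (hC : 0 ≤ C) (hf0 : ∀ q, 0 ≤ f q) (hfL : ∀ q, f q ≤ L * K) (hfE : ∀ q ∈ E, f q ≤ η * K)
    (hgm : AEStronglyMeasurable g μ) (hg01 : ∀ q, 0 ≤ g q ∧ g q ≤ 1)
    (hgE : ∫ q, |g q - E.indicator 1 q| ∂μ ≤ τ) (hp : ∀ q, ‖p q‖ ≤ C) :
    ∫ q, f q * ((g q + τ) * ‖p q‖) ∂μ ≤ C * K * (η * μ.real E + L * τ * (μ.real univ + 1)) := by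
  have hind : Integrable (E.indicator (1 : X → ℝ)) μ := (integrable_const (1 : ℝ)).indicator hE
  have hgi : Integrable g μ := Integrable.of_bound hgm 1 (ae_of_all _ fun q => by
    rw [Real.norm_eq_abs, abs_of_nonneg (hg01 q).1]; exact (hg01 q).2)
  have hdi : Integrable (fun q => |g q - E.indicator 1 q|) μ := (hgi.sub hind).abs
  have h12 : Integrable (fun q => η * K * E.indicator 1 q + L * K * |g q - E.indicator 1 q|) μ :=
    (hind.const_mul _).add (hdi.const_mul _)
  have hBi : Integrable (fun q => C * (η * K * E.indicator 1 q + L * K * |g q - E.indicator 1 q| +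
      τ * (L * K))) μ := (h12.add (integrable_const _)).const_mul C
  have hpt : ∀ q, f q * ((g q + τ) * ‖p q‖) ≤
      C * (η * K * E.indicator 1 q + L * K * |g q - E.indicator 1 q| + τ * (L * K)) := by
    intro q
    have h2 : f q * E.indicator 1 q ≤ η * K * E.indicator 1 q := by
      by_cases hq : q ∈ E
      · simp only [indicator_of_mem hq, Pi.one_apply, mul_one]; exact hfE q hq
      · simp [hq]
    have h3 : f q * |g q - E.indicator 1 q| ≤ L * K * |g q - E.indicator 1 q| :=
      mul_le_mul_of_nonneg_right (hfL q) (abs_nonneg _)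
    have h1 : f q * g q ≤ η * K * E.indicator 1 q + L * K * |g q - E.indicator 1 q| := by
      have hg' : g q ≤ E.indicator 1 q + |g q - E.indicator 1 q| := by
        have := le_abs_self (g q - E.indicator 1 q); linarith
      calc f q * g q ≤ f q * (E.indicator 1 q + |g q - E.indicator 1 q|) :=
            mul_le_mul_of_nonneg_left hg' (hf0 q)
        _ = f q * E.indicator 1 q + f q * |g q - E.indicator 1 q| := mul_add _ _ _
        _ ≤ _ := add_le_add h2 h3
    have h4 : f q * τ ≤ τ * (L * K) := by
      rw [mul_comm]; exact mul_le_mul_of_nonneg_left (hfL q) hτ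
    have h5 : 0 ≤ f q * (g q + τ) := mul_nonneg (hf0 q) (by linarith [(hg01 q).1])
    calc f q * ((g q + τ) * ‖p q‖) = f q * (g q + τ) * ‖p q‖ := by ring
      _ ≤ f q * (g q + τ) * C := mul_le_mul_of_nonneg_left (hp q) h5
      _ = C * (f q * g q + f q * τ) := by ring
      _ ≤ _ := mul_le_mul_of_nonneg_left (add_le_add h1 h4) hC
  calc ∫ q, f q * ((g q + τ) * ‖p q‖) ∂μ
        ≤ ∫ q, C * (η * K * E.indicator 1 q + L * K * |g q - E.indicator 1 q| + τ * (L * K)) ∂μ :=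
        integral_mono_of_nonneg (ae_of_all _ fun q => mul_nonneg (hf0 q)
          (mul_nonneg (by linarith [(hg01 q).1]) (norm_nonneg _))) hBi (ae_of_all _ hpt)
    _ = C * (η * K * μ.real E + L * K * ∫ q, |g q - E.indicator 1 q| ∂μ +
          μ.real univ * (τ * (L * K))) := by
        rw [integral_const_mul, integral_add h12 (integrable_const _),
          integral_add (hind.const_mul _) (hdi.const_mul _), integral_const_mul, integral_const_mul,
          integral_indicator_one hE, integral_const, smul_eq_mul]
    _ ≤ C * (η * K * μ.real E + L * K * τ + μ.real univ * (τ * (L * K))) :=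
        mul_le_mul_of_nonneg_left (add_le_add_left (add_le_add_right
          (mul_le_mul_of_nonneg_left hgE (mul_nonneg hL hK)) _) _) hC
    _ = C * K * (η * μ.real E + L * τ * (μ.real univ + 1)) := by ring

omit [Fintype d] [DecidableEq d] in
/-- The estimate for the remainder piece: if `0 ≤ f ≤ L K`, `f · |1 - ∑ᵢ 1_{Eᵢ}| = 0` a.e.,
`0 ≤ gᵢ ≤ 1` with `‖gᵢ - 1_{Eᵢ}‖_{L¹(μ)} ≤ τ` and `‖p‖ ≤ C`, then
`∫ f (|1 - ∑ᵢ gᵢ| + n τ) ‖p‖ dμ ≤ C K L n τ (μ(univ) + 1)`. [folklore] -/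
theorem integral_remainder_le {X : Type*} [MeasurableSpace X] {μ : Measure X} [IsFiniteMeasure μ]
    {Y : Type*} [NormedAddCommGroup Y] {n : ℕ} {f : X → ℝ} {p : X → Y} {g : Fin n → X → ℝ}
    {E : Fin n → Set X} (hE : ∀ i, MeasurableSet (E i)) {K L τ C : ℝ} (hK : 0 ≤ K) (hL : 0 ≤ L)
    (hτ : 0 ≤ τ) (hC : 0 ≤ C) (hf0 : ∀ q, 0 ≤ f q) (hfL : ∀ q, f q ≤ L * K)
    (hfE : ∀ᵐ q ∂μ, f q * |1 - ∑ i, (E i).indicator (1 : X → ℝ) q| = 0)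
    (hgm : ∀ i, AEStronglyMeasurable (g i) μ) (hg01 : ∀ i q, 0 ≤ g i q ∧ g i q ≤ 1)
    (hgE : ∀ i, ∫ q, |g i q - (E i).indicator 1 q| ∂μ ≤ τ) (hp : ∀ q, ‖p q‖ ≤ C) :
    ∫ q, f q * ((|1 - ∑ i, g i q| + n * τ) * ‖p q‖) ∂μ ≤
      C * K * (L * (n * τ) * (μ.real univ + 1)) := by
  have hind : ∀ i, Integrable ((E i).indicator (1 : X → ℝ)) μ := fun i =>
    (integrable_const (1 : ℝ)).indicator (hE i)
  have hgi : ∀ i, Integrable (g i) μ := fun i => Integrable.of_bound (hgm i) 1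
    (ae_of_all _ fun q => by rw [Real.norm_eq_abs, abs_of_nonneg (hg01 i q).1]; exact (hg01 i q).2)
  have hdi : ∀ i, Integrable (fun q => |g i q - (E i).indicator 1 q|) μ := fun i =>
    ((hgi i).sub (hind i)).abs
  have hsi : Integrable (fun q => ∑ i, |g i q - (E i).indicator 1 q|) μ :=
    integrable_finsetSum _ fun i _ => hdi i
  have hBi : Integrable (fun q => C * (L * K * ∑ i, |g i q - (E i).indicator 1 q| +
      L * K * (n * τ))) μ := ((hsi.const_mul (L * K)).add (integrable_const _)).const_mul C
  have hpt : ∀ᵐ q ∂μ, f q * ((|1 - ∑ i, g i q| + n * τ) * ‖p q‖) ≤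
      C * (L * K * ∑ i, |g i q - (E i).indicator 1 q| + L * K * (n * τ)) := by
    filter_upwards [hfE] with q hq
    have htri : |1 - ∑ i, g i q| ≤
        |1 - ∑ i, (E i).indicator 1 q| + ∑ i, |g i q - (E i).indicator 1 q| := by
      calc |1 - ∑ i, g i q|
            = |(1 - ∑ i, (E i).indicator 1 q) - ∑ i, (g i q - (E i).indicator 1 q)| := by
            rw [Finset.sum_sub_distrib]; congr 1; ring
        _ ≤ |1 - ∑ i, (E i).indicator 1 q| + |∑ i, (g i q - (E i).indicator 1 q)| := abs_sub _ _
        _ ≤ _ := add_le_add_right (Finset.abs_sum_le_sum_abs _ _) _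
    have h1 : f q * |1 - ∑ i, g i q| ≤ L * K * ∑ i, |g i q - (E i).indicator 1 q| := by
      calc f q * |1 - ∑ i, g i q|
            ≤ f q * (|1 - ∑ i, (E i).indicator 1 q| + ∑ i, |g i q - (E i).indicator 1 q|) :=
            mul_le_mul_of_nonneg_left htri (hf0 q)
        _ = f q * |1 - ∑ i, (E i).indicator 1 q| + f q * ∑ i, |g i q - (E i).indicator 1 q| :=
            mul_add _ _ _
        _ = f q * ∑ i, |g i q - (E i).indicator 1 q| := by rw [hq, zero_add]
        _ ≤ _ := mul_le_mul_of_nonneg_right (hfL q) (Finset.sum_nonneg fun i _ => abs_nonneg _)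
    have h4 : f q * (n * τ) ≤ L * K * (n * τ) := mul_le_mul_of_nonneg_right (hfL q) (by positivity)
    have h5 : 0 ≤ f q * (|1 - ∑ i, g i q| + n * τ) := mul_nonneg (hf0 q) (by positivity)
    calc f q * ((|1 - ∑ i, g i q| + n * τ) * ‖p q‖) = f q * (|1 - ∑ i, g i q| + n * τ) * ‖p q‖ := by
          ring
      _ ≤ f q * (|1 - ∑ i, g i q| + n * τ) * C := mul_le_mul_of_nonneg_left (hp q) h5
      _ = C * (f q * |1 - ∑ i, g i q| + f q * (n * τ)) := by ring
      _ ≤ _ := mul_le_mul_of_nonneg_left (add_le_add h1 h4) hC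
  calc ∫ q, f q * ((|1 - ∑ i, g i q| + n * τ) * ‖p q‖) ∂μ
        ≤ ∫ q, C * (L * K * ∑ i, |g i q - (E i).indicator 1 q| + L * K * (n * τ)) ∂μ :=
        integral_mono_of_nonneg (ae_of_all _ fun q => mul_nonneg (hf0 q)
          (mul_nonneg (by positivity) (norm_nonneg _))) hBi hpt
    _ = C * (L * K * ∑ i, ∫ q, |g i q - (E i).indicator 1 q| ∂μ +
          μ.real univ * (L * K * (n * τ))) := by
        rw [integral_const_mul, integral_add (hsi.const_mul _) (integrable_const _),
          integral_const_mul, integral_finsetSum _ (fun i _ => hdi i), integral_const, smul_eq_mul]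
    _ ≤ C * (L * K * ∑ _i : Fin n, τ + μ.real univ * (L * K * (n * τ))) :=
        mul_le_mul_of_nonneg_left (add_le_add_left (mul_le_mul_of_nonneg_left
          (Finset.sum_le_sum fun i _ => hgE i) (mul_nonneg hL hK)) _) hC
    _ = C * K * (L * (n * τ) * (μ.real univ + 1)) := by
        rw [Finset.sum_const, Finset.card_univ, Fintype.card_fin, nsmul_eq_mul]; ring

/-! ### The discharge -/

/-- **De Rosa–Inversi 2024, Thm. 1.2 on the flat torus** — discharge of the named fact
`DeRosaInversi2024_thm12`: a jointly measurable, weakly divergence-free field `u` on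
`(0,T) × T^d`, locally of class `L¹_t BV_x ∩ L^∞_{t,x}`, has vanishing Duchon–Robert defect:
`D ψ = 0` for every test function `ψ` supported in `(0, T) × T^d`, whenever
`Torus.HasDuchonRobertDefect T u D` (the kernel-independent defect). Proof: De Rosa–Inversi 2024,
§4 (Ambrosio's anisotropic kernel optimisation, Alberti's lemma), as assembled in the module
docstring. [cite: DeRosaInversi2024, Thm. 1.2 and §4] -/
theorem duchonRobertDefect_eq_zero_of_BV : DeRosaInversi2024_thm12 := by
  intro d _ _ T u D hT hmeas hdiv hbdd hBV hD ψ hψ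
  classical
  obtain ⟨ρ₀, hρ₀⟩ := FluidPDE.exists_isMollifier (d := d)
  have hψ' := hψ
  obtain ⟨⟨hψs, T', hT'T, hψT'⟩, ε₀, hε₀, hψε₀⟩ := hψ
  /- the trivial case `ψ = 0` -/
  by_cases hcase : T' ≤ ε₀
  · have hψ0 : ψ = 0 := by
      funext t x
      by_cases ht : t ≤ ε₀
      · simp [hψε₀ t ht]
      · simp [hψT' t (hcase.trans (le_of_lt (not_le.1 ht)))]
    rw [hψ0]
    exact defect_zero hD
  rw [not_le] at hcase
  /- time parameters `0 < a = ε₀/2 < a' = ε₀ < b' = T' < b = (T'+T)/2 < T` -/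
  have ha0 : (0 : ℝ) < ε₀ / 2 := by positivity
  have haa' : ε₀ / 2 < ε₀ := by linarith
  have hb'b : T' < (T' + T) / 2 := by linarith
  have hbT : (T' + T) / 2 < T := by linarith
  have hab : ε₀ / 2 ≤ (T' + T) / 2 := by linarith
  have hsub : Icc ε₀ T' ⊆ Icc (ε₀ / 2) ((T' + T) / 2) := Icc_subset_Icc haa'.le hb'b.le
  have hslab : Icc (ε₀ / 2) ((T' + T) / 2) ⊆ Ioo 0 T := fun t ht =>
    ⟨ha0.trans_le ht.1, ht.2.trans_lt hbT⟩
  have hψsupp : ∀ t ∉ Icc ε₀ T', ψ t = 0 := by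
    intro t ht
    simp only [mem_Icc, not_and_or, not_le] at ht
    rcases ht with ht | ht
    · exact hψε₀ t ht.le
    · exact hψT' t ht.le
  /- the cut-off in time -/
  obtain ⟨ζ, hζs, hζ01, hζone, hζ0⟩ := exists_time_cutoff haa' hcase.le hb'b
  have hζc : Continuous ζ := hζs.continuous
  have hζ1 : ∀ t, |ζ t| ≤ 1 := fun t => by
    rw [abs_of_nonneg (hζ01 t).1]; exact (hζ01 t).2
  /- the bounded representative `w` of `u` on the slab -/
  obtain ⟨M₀, hM₀⟩ := hbdd (ε₀ / 2) ((T' + T) / 2) ha0 hab hbT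
  obtain ⟨Mbd, hMbddef⟩ : ∃ Mbd : ℝ, Mbd = max M₀ 1 := ⟨_, rfl⟩
  have hMbd0 : 0 ≤ Mbd := by rw [hMbddef]; exact zero_le_one.trans (le_max_right _ _)
  have hbdd' : ∀ᵐ t ∂(volume.restrict (Icc (ε₀ / 2) ((T' + T) / 2))),
      ∀ᵐ x : UnitAddTorus d, ‖u t x‖ ≤ Mbd :=
    hM₀.mono fun t ht => ht.mono fun x hx => hx.trans (by rw [hMbddef]; exact le_max_left _ _)
  have hmeas' : AEStronglyMeasurable (uncurry u)
      (volume.restrict (Icc (ε₀ / 2) ((T' + T) / 2) ×ˢ univ)) :=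
    (Torus.aestronglyMeasurable_uncurry_of_stLift_restrict hmeas).mono_measure
      (Measure.restrict_mono (prod_mono hslab subset_rfl) le_rfl)
  obtain ⟨w, hw, hwb, -, huw⟩ := exists_bounded_representative hMbd0 hmeas' hbdd'
  have hBVw : ∫⁻ t in Icc (ε₀ / 2) ((T' + T) / 2), torusTotalVariation (w t) ≠ ⊤ := by
    rw [lintegral_congr_ae (huw.mono fun t ht => torusTotalVariation_congr_ae ht)]
    exact (hBV _ _ ha0 hab hbT).ne
  have hdivw : ∀ᵐ t ∂(volume.restrict (Icc (ε₀ / 2) ((T' + T) / 2))),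
      Torus.IsWeaklyDivFree (w t) := by
    filter_upwards [ae_restrict_of_ae_restrict_of_subset hslab hdiv, huw] with t h1 h2
    exact isWeaklyDivFree_congr_ae h2 h1
  /- the structure theorem -/
  obtain ⟨μ, M, hμfin, hM, hMK', htr, hrep⟩ := exists_density hw hwb hζc hζ1 hζ0 hBVw hdivw
  haveI := hμfin
  obtain ⟨K, hKdef⟩ : ∃ K : ℝ, K = (Fintype.card d : ℝ) ^ 2 := ⟨_, rfl⟩
  have hMK : ∀ q, ‖M q‖ ≤ K := fun q => (hMK' q).trans_eq hKdef.symm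
  have hK0 : 0 ≤ K := by rw [hKdef]; positivity
  have hμr0 : 0 ≤ μ.real univ := measureReal_nonneg
  /- data of `ψ` -/
  obtain ⟨hψc, Cψ, hCψ⟩ := continuous_uncurry_and_bounded hψs hψsupp
  have hCψ0 : 0 ≤ Cψ := (norm_nonneg _).trans (hCψ (0, 0))
  have hψcs : HasCompactSupport (uncurry ψ) := by
    refine HasCompactSupport.intro' (K := Icc ε₀ T' ×ˢ (univ : Set (UnitAddTorus d)))
      (isCompact_Icc.prod isCompact_univ) (isClosed_Icc.prod isClosed_univ) fun q hq => ?_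
    have ht : q.1 ∉ Icc ε₀ T' := fun h => hq ⟨h, mem_univ _⟩
    show ψ q.1 q.2 = 0
    rw [hψsupp q.1 ht]
    rfl
  /- the flux bound, specialised to the present data -/
  have hflux : ∀ {θ : ℝ → UnitAddTorus d → ℝ}, Torus.IsSpaceTimeTestIoo T θ →
      (∀ t ∉ Icc ε₀ T', θ t = 0) → ∀ {Θ : ℝ × UnitAddTorus d → ℝ}, Continuous Θ →
      HasCompactSupport Θ → (∀ q, 0 ≤ Θ q) → (∀ t x, |θ t x| ≤ Θ (t, x)) →
      ∀ {ρ : EuclideanSpace ℝ d → ℝ}, FluidPDE.IsMollifier ρ →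
        |D θ| ≤ Mbd ^ 2 * ∫ q, (∫ z, |fderiv ℝ ρ z (M q z)|) * Θ q ∂μ :=
    fun hθ hθsupp _ hΘc hΘs hΘ0 hθΘ _ hρ =>
      abs_defect_le hD hw hwb hsub huw hζc hζ1 hζ0 hζone hM hMK hrep hθ hθsupp hΘc hΘs hΘ0 hθΘ hρ
  /- it suffices to prove `|D ψ| ≤ C η` for every `η > 0` -/
  suffices hmain : ∀ η : ℝ, 0 < η →
      |D ψ| ≤ (Mbd ^ 2 * Cψ * K * (μ.real univ + 2) + 1) * η by
    by_contra hne
    have hpos : 0 < |D ψ| := abs_pos.2 hne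
    have hC0 : 0 < Mbd ^ 2 * Cψ * K * (μ.real univ + 2) + 1 := by positivity
    have h := hmain (|D ψ| / (2 * (Mbd ^ 2 * Cψ * K * (μ.real univ + 2) + 1))) (by positivity)
    rw [mul_comm, div_mul_eq_mul_div, mul_div_mul_right _ _ hC0.ne'] at h
    linarith
  intro η hη
  /- Step 1: the finite kernel family and the measurable pieces -/
  obtain ⟨n, ρs, sel, hρs, hselm, hselcov, hselb⟩ := exists_finite_kernel_family (d := d) hη
  obtain ⟨Es, hEs⟩ : ∃ Es : Fin n → Set (ℝ × UnitAddTorus d),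
      Es = fun i => {q | sel (M q) = some i} := ⟨_, rfl⟩
  have hmemE : ∀ {i : Fin n} {q : ℝ × UnitAddTorus d}, q ∈ Es i ↔ sel (M q) = some i := by
    intro i q; rw [hEs]; exact Iff.rfl
  have hEm : ∀ i, MeasurableSet (Es i) := fun i => by
    rw [hEs]; exact hM.measurable (hselm i)
  have hEdisj : Pairwise (Disjoint on Es) := fun i j hij =>
    Set.disjoint_left.2 fun q hqi hqj =>
      hij (Option.some_injective _ ((hmemE.1 hqi).symm.trans (hmemE.1 hqj)))
  -- energies and their bounds
  have hLnn : ∀ ρ : EuclideanSpace ℝ d → ℝ, 0 ≤ ∫ z, ‖fderiv ℝ ρ z‖ * ‖z‖ := fun ρ =>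
    integral_nonneg fun z => by positivity
  have hhnn : ∀ (ρ : EuclideanSpace ℝ d → ℝ) (q : ℝ × UnitAddTorus d),
      0 ≤ ∫ z, |fderiv ℝ ρ z (M q z)| := fun ρ q => integral_nonneg fun z => abs_nonneg _
  have hhL : ∀ {ρ : EuclideanSpace ℝ d → ℝ}, FluidPDE.IsMollifier ρ → ∀ q : ℝ × UnitAddTorus d,
      ∫ z, |fderiv ℝ ρ z (M q z)| ≤ (∫ z, ‖fderiv ℝ ρ z‖ * ‖z‖) * K := fun hρ q =>
    (integral_abs_fderiv_apply_le (hρ.1.of_le (by simp)) hρ.2.1 (M q)).trans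
      (mul_le_mul_of_nonneg_left (hMK q) (hLnn _))
  have hhE : ∀ i, ∀ q ∈ Es i, ∫ z, |fderiv ℝ (ρs i) z (M q z)| ≤ η * K := fun i q hq =>
    (hselb (M q) i (hmemE.1 hq)).trans (mul_le_mul_of_nonneg_left (hMK q) hη.le)
  -- the small parameter `τ`
  obtain ⟨Lsum, hLsum⟩ : ∃ Lsum : ℝ, Lsum = ∑ i, ∫ z, ‖fderiv ℝ (ρs i) z‖ * ‖z‖ := ⟨_, rfl⟩
  have hLsum0 : 0 ≤ Lsum := by rw [hLsum]; exact Finset.sum_nonneg fun i _ => hLnn _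
  obtain ⟨L0, hL0⟩ : ∃ L0 : ℝ, L0 = ∫ z, ‖fderiv ℝ ρ₀ z‖ * ‖z‖ := ⟨_, rfl⟩
  have hL0nn : 0 ≤ L0 := by rw [hL0]; exact hLnn _
  obtain ⟨τ, hτdef⟩ : ∃ τ : ℝ, τ = η / ((Lsum + L0 * n + 1) * (μ.real univ + 1)) := ⟨_, rfl⟩
  have hτ : 0 < τ := by rw [hτdef]; positivity
  have hτkey : (Lsum + L0 * n) * (τ * (μ.real univ + 1)) ≤ η := by
    have hS1 : 0 < Lsum + L0 * n + 1 := by positivity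
    have hU1 : μ.real univ + 1 ≠ 0 := by positivity
    have hτU : τ * (μ.real univ + 1) = η / (Lsum + L0 * n + 1) := by
      rw [hτdef, div_mul_eq_mul_div, mul_div_mul_right _ _ hU1]
    rw [hτU, ← mul_div_assoc, div_le_iff₀ hS1]
    nlinarith [hLsum0, hL0nn, hη.le]
  /- Step 2: continuous and smooth approximations of the indicators -/
  have hex1 : ∀ i : Fin n, ∃ g : ℝ × UnitAddTorus d → ℝ, Continuous g ∧
      (∀ q, 0 ≤ g q ∧ g q ≤ 1) ∧ ∫ q, |g q - (Es i).indicator 1 q| ∂μ ≤ τ := fun i =>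
    exists_continuous_approx_indicator (hEm i) hτ
  choose g hgc hg01 hgE using hex1
  have hex2 : ∀ i : Fin n, ∃ χ : ℝ → UnitAddTorus d → ℝ, ContDiff ℝ ∞ (Torus.stLift χ) ∧
      (∀ t x, |χ t x| ≤ g i (t, x) + τ) ∧
        ∀ q ∈ tsupport (uncurry ψ), |χ q.1 q.2 - g i q| ≤ τ := fun i =>
    exists_smooth_cutoff_approx (hgc i) (hg01 i) (Kc := tsupport (uncurry ψ)) hψcs hτ
  choose χ hχs hχg hχK using hex2
  /- Step 3: the decomposition of `ψ` and additivity of the defect -/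
  obtain ⟨θ, hθdef⟩ : ∃ θ : Fin n → ℝ → UnitAddTorus d → ℝ,
      θ = fun i t x => χ i t x * ψ t x := ⟨_, rfl⟩
  obtain ⟨θ0, hθ0def⟩ : ∃ θ0 : ℝ → UnitAddTorus d → ℝ,
      θ0 = fun t x => (1 - ∑ i, χ i t x) * ψ t x := ⟨_, rfl⟩
  have hsm : ContDiff ℝ ∞ (Torus.stLift fun t x => 1 - ∑ i, χ i t x) := by
    have : Torus.stLift (fun t x => 1 - ∑ i, χ i t x) =
        fun p => 1 - ∑ i, Torus.stLift (χ i) p := rfl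
    rw [this]
    exact contDiff_const.sub (ContDiff.sum fun i _ => hχs i)
  have hθtest : ∀ i, Torus.IsSpaceTimeTestIoo T (θ i) := fun i => by
    rw [hθdef]; exact isSpaceTimeTestIoo_mul (hχs i) hψ'
  have hθ0test : Torus.IsSpaceTimeTestIoo T θ0 := by
    rw [hθ0def]; exact isSpaceTimeTestIoo_mul hsm hψ'
  have hθsupp : ∀ i, ∀ t ∉ Icc ε₀ T', θ i t = 0 := fun i t ht => by
    rw [hθdef]; funext x; simp [hψsupp t ht]
  have hθ0supp : ∀ t ∉ Icc ε₀ T', θ0 t = 0 := fun t ht => by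
    rw [hθ0def]; funext x; simp [hψsupp t ht]
  have hDsum : D ψ = (∑ i, D (θ i)) + D θ0 := by
    have hdecomp : ψ = (∑ i, θ i) + θ0 := by
      funext t x
      simp only [Pi.add_apply, Finset.sum_apply, hθdef, hθ0def]
      rw [← Finset.sum_mul]
      ring
    have hs0 : ∀ t ∉ Icc ε₀ T', (∑ i, θ i) t = 0 := fun t ht => by
      rw [Finset.sum_apply]; exact Finset.sum_eq_zero fun i _ => hθsupp i t ht
    conv_lhs => rw [hdecomp]
    rw [defect_add hD hw hwb hsub huw (isSpaceTimeTestIoo_sum _ fun i _ => hθtest i) hθ0test hs0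
      hθ0supp, defect_sum hD hw hwb hsub huw Finset.univ (fun i _ => hθtest i) fun i _ => hθsupp i]
  /- Step 4: the dominating weights -/
  obtain ⟨Θ, hΘdef⟩ : ∃ Θ : Fin n → ℝ × UnitAddTorus d → ℝ,
      Θ = fun i q => (g i q + τ) * ‖uncurry ψ q‖ := ⟨_, rfl⟩
  obtain ⟨Θ0, hΘ0def⟩ : ∃ Θ0 : ℝ × UnitAddTorus d → ℝ,
      Θ0 = fun q => (|1 - ∑ i, g i q| + n * τ) * ‖uncurry ψ q‖ := ⟨_, rfl⟩
  have hΘc : ∀ i, Continuous (Θ i) := fun i => by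
    rw [hΘdef]; exact ((hgc i).add continuous_const).mul hψc.norm
  have hΘ0c : Continuous Θ0 := by
    rw [hΘ0def]
    exact ((continuous_const.sub (continuous_finsetSum _ fun i _ => hgc i)).abs.add
      continuous_const).mul hψc.norm
  have hΘs : ∀ i, HasCompactSupport (Θ i) := fun i => by
    rw [hΘdef]; exact hψcs.norm.mul_left (f := fun q => g i q + τ)
  have hΘ0s : HasCompactSupport Θ0 := by
    rw [hΘ0def]; exact hψcs.norm.mul_left (f := fun q => |1 - ∑ i, g i q| + n * τ)
  have hΘnn : ∀ i q, 0 ≤ Θ i q := fun i q => by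
    rw [hΘdef]; exact mul_nonneg (by linarith [(hg01 i q).1]) (norm_nonneg _)
  have hΘ0nn : ∀ q, 0 ≤ Θ0 q := fun q => by
    rw [hΘ0def]; exact mul_nonneg (by positivity) (norm_nonneg _)
  have hθΘ : ∀ i t x, |θ i t x| ≤ Θ i (t, x) := fun i t x => by
    rw [hΘdef, hθdef]
    show |χ i t x * ψ t x| ≤ (g i (t, x) + τ) * ‖ψ t x‖
    rw [abs_mul, ← Real.norm_eq_abs (ψ t x)]
    exact mul_le_mul_of_nonneg_right (hχg i t x) (norm_nonneg _)
  have hθ0Θ : ∀ t x, |θ0 t x| ≤ Θ0 (t, x) := fun t x => by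
    rw [hΘ0def, hθ0def]
    show |(1 - ∑ i, χ i t x) * ψ t x| ≤ (|1 - ∑ i, g i (t, x)| + n * τ) * ‖ψ t x‖
    rw [abs_mul, ← Real.norm_eq_abs (ψ t x)]
    by_cases hψq : ψ t x = 0
    · simp [hψq]
    · refine mul_le_mul_of_nonneg_right ?_ (norm_nonneg _)
      have hq : (t, x) ∈ tsupport (uncurry ψ) :=
        subset_tsupport _ (by simpa [uncurry] using hψq)
      calc |1 - ∑ i, χ i t x|
            = |(1 - ∑ i, g i (t, x)) - ∑ i, (χ i t x - g i (t, x))| := by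
            rw [Finset.sum_sub_distrib]; congr 1; ring
        _ ≤ |1 - ∑ i, g i (t, x)| + |∑ i, (χ i t x - g i (t, x))| := abs_sub _ _
        _ ≤ |1 - ∑ i, g i (t, x)| + ∑ i, |χ i t x - g i (t, x)| :=
            add_le_add_right (Finset.abs_sum_le_sum_abs _ _) _
        _ ≤ |1 - ∑ i, g i (t, x)| + ∑ _i : Fin n, τ :=
            add_le_add_right (Finset.sum_le_sum fun i _ => hχK i (t, x) hq) _
        _ = |1 - ∑ i, g i (t, x)| + n * τ := by
            rw [Finset.sum_const, Finset.card_univ, Fintype.card_fin, nsmul_eq_mul]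
  /- Step 5: the bounds for the pieces -/
  have hDi : ∀ i, |D (θ i)| ≤ Mbd ^ 2 * (Cψ * K * (η * μ.real (Es i) +
      (∫ z, ‖fderiv ℝ (ρs i) z‖ * ‖z‖) * τ * (μ.real univ + 1))) := fun i => by
    refine (hflux (hθtest i) (hθsupp i) (hΘc i) (hΘs i) (hΘnn i) (hθΘ i) (hρs i)).trans ?_
    refine mul_le_mul_of_nonneg_left ?_ (by positivity)
    simp only [hΘdef]
    exact integral_piece_le (hEm i) hK0 (hLnn _) hτ.le hCψ0 (fun q => hhnn _ q)
      (hhL (hρs i)) (hhE i) (hgc i).aestronglyMeasurable (hg01 i) (hgE i) hCψ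
  have hae : ∀ᵐ q ∂μ, (∫ z, |fderiv ℝ ρ₀ z (M q z)|) *
      |1 - ∑ i, (Es i).indicator (1 : ℝ × UnitAddTorus d → ℝ) q| = 0 := by
    filter_upwards [htr] with q hq
    by_cases hMq : M q = 0
    · have h0 : (∫ z, |fderiv ℝ ρ₀ z (M q z)|) = 0 := by simp [hMq]
      rw [h0, zero_mul]
    · obtain ⟨i, hi⟩ := hselcov (M q) hq hMq
      have hsum : ∑ j, (Es j).indicator (1 : ℝ × UnitAddTorus d → ℝ) q = 1 := by
        rw [Finset.sum_eq_single i]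
        · simp [hmemE.2 hi]
        · intro j _ hji
          have hqj : q ∉ Es j := fun hqj =>
            hji (Option.some_injective _ ((hmemE.1 hqj).symm.trans hi))
          simp [hqj]
        · exact fun h => absurd (Finset.mem_univ i) h
      rw [hsum, sub_self, abs_zero, mul_zero]
  have hD0 : |D θ0| ≤ Mbd ^ 2 * (Cψ * K * (L0 * (n * τ) * (μ.real univ + 1))) := by
    refine (hflux hθ0test hθ0supp hΘ0c hΘ0s hΘ0nn hθ0Θ hρ₀).trans ?_
    refine mul_le_mul_of_nonneg_left ?_ (by positivity)
    simp only [hΘ0def]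
    exact integral_remainder_le hEm hK0 hL0nn hτ.le hCψ0 (fun q => hhnn _ q)
      (fun q => (hhL hρ₀ q).trans_eq (by rw [hL0])) hae (fun i => (hgc i).aestronglyMeasurable)
      hg01 hgE hCψ
  /- Step 6: summation -/
  have hsumE : ∑ i, μ.real (Es i) ≤ μ.real univ := by
    rw [← measureReal_iUnion_fintype hEdisj hEm]
    exact measureReal_mono (subset_univ _)
  have hP : 0 ≤ Mbd ^ 2 * Cψ * K := by positivity
  have hsum1 : ∑ i, |D (θ i)| ≤ Mbd ^ 2 * Cψ * K * η * μ.real univ +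
      Mbd ^ 2 * Cψ * K * (τ * (μ.real univ + 1)) * Lsum := by
    calc ∑ i, |D (θ i)|
          ≤ ∑ i, (Mbd ^ 2 * Cψ * K * η * μ.real (Es i) +
            Mbd ^ 2 * Cψ * K * (τ * (μ.real univ + 1)) * ∫ z, ‖fderiv ℝ (ρs i) z‖ * ‖z‖) :=
          Finset.sum_le_sum fun i _ => (hDi i).trans_eq (by ring)
      _ = Mbd ^ 2 * Cψ * K * η * ∑ i, μ.real (Es i) +
            Mbd ^ 2 * Cψ * K * (τ * (μ.real univ + 1)) * Lsum := by
          rw [Finset.sum_add_distrib, ← Finset.mul_sum, ← Finset.mul_sum, ← hLsum]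
      _ ≤ _ := add_le_add_left (mul_le_mul_of_nonneg_left hsumE (by positivity)) _
  calc |D ψ| = |(∑ i, D (θ i)) + D θ0| := by rw [hDsum]
    _ ≤ ∑ i, |D (θ i)| + |D θ0| :=
        (abs_add_le _ _).trans (add_le_add_left (Finset.abs_sum_le_sum_abs _ _) _)
    _ ≤ Mbd ^ 2 * Cψ * K * η * μ.real univ + Mbd ^ 2 * Cψ * K * (τ * (μ.real univ + 1)) * Lsum +
          Mbd ^ 2 * (Cψ * K * (L0 * (n * τ) * (μ.real univ + 1))) := add_le_add hsum1 hD0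
    _ = Mbd ^ 2 * Cψ * K * (η * μ.real univ) +
          Mbd ^ 2 * Cψ * K * ((Lsum + L0 * n) * (τ * (μ.real univ + 1))) := by ring
    _ ≤ Mbd ^ 2 * Cψ * K * (η * μ.real univ) + Mbd ^ 2 * Cψ * K * η :=
        add_le_add_right (mul_le_mul_of_nonneg_left hτkey hP) _
    _ = Mbd ^ 2 * Cψ * K * (μ.real univ + 1) * η := by ring
    _ ≤ (Mbd ^ 2 * Cψ * K * (μ.real univ + 2) + 1) * η :=
        mul_le_mul_of_nonneg_right (by nlinarith [hP]) hη.le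

end Assembly

end CodimensionOneRigidity

/-- **De Rosa–Inversi 2024, Thm. 1.2** — the discharge under the conventional name next to the
named fact (`Literature.Barriers.AnomalousDissipation.DeRosaInversi2024_thm12_holds`).
[cite: DeRosaInversi2024, Thm. 1.2 and §4] -/
theorem DeRosaInversi2024_thm12_holds : DeRosaInversi2024_thm12 :=
  CodimensionOneRigidity.duchonRobertDefect_eq_zero_of_BV

end Literature.Barriers.AnomalousDissipation

end
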